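import Summits.AtomisticToContinuum.HydrodynamicLimit.Theorems.InformationPercolationEngineLocalSecondLawInitialMatchingTV
import Summits.AtomisticToContinuum.HydrodynamicLimit.Theorems.JParityClosureLocalSecondLawContactVelocityTiltBudget
import Summits.AtomisticToContinuum.HydrodynamicLimit.Theorems.InformationPercolationEngineLocalSecondLawInitialMatchingTools

/-!
# Stub B′|ML (`stub_initialMatchingOfStatics`) of the line `contact-asymmetry-information` for the crux `LocalSecondLaw`
(stmt-AtomisticToContinuum-13081) — part 3a: normalised bounded velocity tilts and the truncated log-ratio tilt

For the local Gibbs law `P_N`, a cell `S` of positive mass, the tilt `ν = P_N(·|S)` and a one-particle density `f` of `ν`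
on `[0,τ]`, write `n_S(y) = ∫ f(0,y,v) dv` and `M_y = M_{1,u₀(y),θ₀(y)}` (the local Maxwellian of the profiles).  The landed
duality `contactB_velocityTiltBudget_bdd` (a5) says `∫∫ ψ f(0,·) ≤ log(1/P_N(S))/(N+1)` for every BOUNDED measurable velocity
tilt `ψ` with `∫ e^{ψ(y,·)} dN(u₀(y),θ₀(y)𝟙) ≤ 1`.  This file performs the truncation / normalisation / Fatou argument that
turns it into the full **velocity relative-entropy budget**

  `∫∫ f(0,y,v) log ( f(0,y,v) / (n_S(y) M_y(v)) ) dv dy ≤ log(1/P_N(S))/(N+1)`   (`kl_velocity_budget`),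

including the integrability of the integrand (the conditioning lemma on the velocity side: conditioning on an event of mass
`≥ δ″` moves the one-particle VELOCITY law away from the local Maxwellians by `O(log(1/δ″)/N)` nats only).  Steps:
* `kl_le_budget_add_of_bounded` — for any bounded measurable `c`, the normalised tilt `ψ = c − log Z`, `Z(y) = ∫ e^{c(y,v)} M_y(v) dv`,
  is admissible, whence `∫∫ c f ≤ b + ∫ n_S log Z`;
* `kl_Z_trunc_le` — for the truncation `c_K = 𝟙[f=0]·(−K) + 𝟙[f>0]·clamp_{[−K,K]} log(f/(n_S M))` one has `Z ≤ 1 + e^{−K}` at EVERY `y`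
  (no Jensen: `e^{clamp L} ≤ e^{L} + e^{−K}` and `∫_{f>0} f/n_S dv ≤ 1`), so `∫∫ c_K f ≤ b + e^{−K}`;
* `kl_velocity_budget` — `K → ∞` by Fatou against the integrable minorant `−n_S M` (`t log t ≥ −1`).

References: I. Csiszár, Ann. Probab. 3 (1975) 146–158; M. D. Donsker, S. R. S. Varadhan, Comm. Pure Appl. Math. 28 (1975) 1–47
(variational formula for the relative entropy); H. Spohn, *Large Scale Dynamics of Interacting Particles* (1991), Part I §2.3.
Lead c16 (prover-line-stmt-AtomisticToContinuum-13081-c16-0).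
-/

noncomputable section

open scoped BigOperators Topology Classical MeasureTheory ENNReal InnerProductSpace
open Filter Set MeasureTheory Function
open Literature.MathematicalPhysics.KineticTheory
open Literature.Analysis.FluidPDE
open Summit.AtomisticToContinuum.HydrodynamicLimit.Theorems.LocalSecondLawNegative
open Summit.AtomisticToContinuum.HydrodynamicLimit.Theorems.LocalSecondLawLedger
open Summit.AtomisticToContinuum.HydrodynamicLimit.Theorems.LocalSecondLawContact

namespace Summit.AtomisticToContinuum.HydrodynamicLimit.Theorems.LocalSecondLawInitialMatching

variable {N : ℕ}

/-! ### Local Maxwellians of the profiles -/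

/-- `(y, v) ↦ M_{1,u₀(y),θ₀(y)}(v)` is jointly measurable for continuous profiles. -/
theorem kl_measurable_maxwellian {θ₀ : T3 → ℝ} {u₀ : T3 → V3} (hθ : Continuous θ₀) (hu : Continuous u₀) :
    Measurable fun p : T3 × V3 => localMaxwellian 1 (θ₀ p.1) (u₀ p.1) p.2 :=
  EvenStressEnskog.measurable_localMaxwellian_one_comp (hθ.measurable.comp measurable_fst) (hu.measurable.comp measurable_fst)
    measurable_snd

/-- **Integration against the Gaussian is integration against the local Maxwellian density**:
`∫ g dN(u, θ𝟙) = ∫ M_{1,u,θ}(v) g(v) dv` (`θ > 0`). -/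
theorem kl_integral_gauss_eq {θ : ℝ} (hθ : 0 < θ) (u : V3) (g : V3 → ℝ) :
    ∫ v, g v ∂(gaussMeasure u θ) = ∫ v, localMaxwellian 1 θ u v * g v := by
  rw [← withDensity_localMaxwellian_eq_gaussMeasure hθ u,
    integral_withDensity_eq_integral_toReal_smul₀
      (continuous_localMaxwellian 1 θ u).measurable.ennreal_ofReal.aemeasurable
      (Eventually.of_forall fun _ => ENNReal.ofReal_lt_top)]
  refine integral_congr_ae (ae_of_all _ fun v => ?_)
  show (ENNReal.ofReal (localMaxwellian 1 θ u v)).toReal • g v = localMaxwellian 1 θ u v * g v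
  rw [ENNReal.toReal_ofReal (localMaxwellian_nonneg zero_le_one hθ.le u v), smul_eq_mul]

/-! ### Step 1: bounded tilts, normalised -/

/-- The partition function `Z(y) = ∫ e^{c(y,v)} M_y(v) dv` of a tilt with `|c| ≤ K` lies in `[e^{−K}, e^{K}]`. -/
theorem kl_Z_mem {θ₀ : T3 → ℝ} {u₀ : T3 → V3} (hθ0 : ∀ x, 0 < θ₀ x) {c : T3 × V3 → ℝ} (hcm : Measurable c)
    {K : ℝ} (hcK : ∀ p, |c p| ≤ K) (y : T3) :
    Real.exp (-K) ≤ ∫ v, Real.exp (c (y, v)) * localMaxwellian 1 (θ₀ y) (u₀ y) v ∧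
      ∫ v, Real.exp (c (y, v)) * localMaxwellian 1 (θ₀ y) (u₀ y) v ≤ Real.exp K := by
  have hMi : Integrable (localMaxwellian 1 (θ₀ y) (u₀ y)) := integrable_localMaxwellian (hθ0 y) (u₀ y)
  have hM1 : ∫ v, localMaxwellian 1 (θ₀ y) (u₀ y) v = 1 := integral_localMaxwellian_one (hθ0 y) (u₀ y)
  have hM0 : ∀ v, 0 ≤ localMaxwellian 1 (θ₀ y) (u₀ y) v := fun v => localMaxwellian_nonneg zero_le_one (hθ0 y).le _ _
  have hem : AEStronglyMeasurable (fun v => Real.exp (c (y, v))) volume :=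
    (Real.measurable_exp.comp (hcm.comp (measurable_const.prodMk measurable_id))).aestronglyMeasurable
  have hlo : ∀ v, Real.exp (-K) ≤ Real.exp (c (y, v)) := fun v => Real.exp_le_exp.2 (abs_le.1 (hcK _)).1
  have hhi : ∀ v, Real.exp (c (y, v)) ≤ Real.exp K := fun v => Real.exp_le_exp.2 (abs_le.1 (hcK _)).2
  have hint : Integrable fun v => Real.exp (c (y, v)) * localMaxwellian 1 (θ₀ y) (u₀ y) v :=
    hMi.bdd_mul hem (ae_of_all _ fun v => by
      rw [Real.norm_eq_abs, abs_of_pos (Real.exp_pos _)]; exact hhi v)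
  constructor
  · calc Real.exp (-K) = ∫ v, Real.exp (-K) * localMaxwellian 1 (θ₀ y) (u₀ y) v := by
          rw [integral_const_mul, hM1, mul_one]
      _ ≤ _ := integral_mono (hMi.const_mul _) hint fun v => mul_le_mul_of_nonneg_right (hlo v) (hM0 v)
  · calc ∫ v, Real.exp (c (y, v)) * localMaxwellian 1 (θ₀ y) (u₀ y) v
        ≤ ∫ v, Real.exp K * localMaxwellian 1 (θ₀ y) (u₀ y) v :=
          integral_mono hint (hMi.const_mul _) fun v => mul_le_mul_of_nonneg_right (hhi v) (hM0 v)
      _ = Real.exp K := by rw [integral_const_mul, hM1, mul_one]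

/-- The partition function of a bounded measurable tilt is measurable in the position. -/
theorem kl_measurable_Z {θ₀ : T3 → ℝ} {u₀ : T3 → V3} (hθ : Continuous θ₀) (hu : Continuous u₀)
    {c : T3 × V3 → ℝ} (hcm : Measurable c) :
    Measurable fun y : T3 => ∫ v, Real.exp (c (y, v)) * localMaxwellian 1 (θ₀ y) (u₀ y) v := by
  have hm : Measurable fun p : T3 × V3 => Real.exp (c p) * localMaxwellian 1 (θ₀ p.1) (u₀ p.1) p.2 :=
    (Real.measurable_exp.comp hcm).mul (kl_measurable_maxwellian hθ hu)
  exact (hm.stronglyMeasurable.integral_prod_right').measurable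

/-- **Budget of a bounded tilt after normalisation.**  For the local Gibbs law (continuous profiles, `σ ≤ 1/2`), a cell `S`
of positive mass, a one-particle density `f` of `P_N(·|S)` on `[0,τ]` and a bounded measurable `c` (`|c| ≤ K`):
`∫∫ c f(0,·) ≤ log(1/P_N(S))/(N+1) + ∫ n_S(y) log Z(y) dy`, `Z(y) = ∫ e^{c(y,v)} M_y(v) dv`
(the tilt `ψ = c − log Z ∘ fst` is bounded, measurable and exactly normalised, so `contactB_velocityTiltBudget_bdd` applies). -/
theorem kl_le_budget_add_of_bounded : ∀ {a₀ θ₀ : T3 → ℝ} {u₀ : T3 → V3} (ha : Continuous a₀) (hθ : Continuous θ₀) (hu : Continuous u₀) (ha0 : ∀ x, 0 < a₀ x) (hθ0 : ∀ x, 0 < θ₀ x) {σ : ℝ}, σ ≤ 1 / 2 → ∀ {N : ℕ} {τ : ℝ}, 0 ≤ τ → ∀ (Φ : Flow σ N) (S : Set (Phase N)) (f : Pt1 → ℝ), localGibbsLaw σ a₀ u₀ θ₀ N Φ S ≠ 0 → IsOneParticleDensity τ (condLaw (localGibbsLaw σ a₀ u₀ θ₀ N Φ) S) Φ f → ∀ {c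 : T3 × V3 → ℝ}, Measurable c → ∀ {K : ℝ}, (∀ p, |c p| ≤ K) → ∫ p : T3 × V3, c p * f (0, p) ≤ Real.log ((localGibbsLaw σ a₀ u₀ θ₀ N Φ S).toReal⁻¹) / (N + 1) + ∫ y : T3, (∫ v : V3, f (0, y, v)) * Real.log (∫ v, Real.exp (c (y, v)) * localMaxwellian 1 (θ₀ y) (u₀ y) v) := by
  intro a₀ θ₀ u₀ ha hθ hu ha0 hθ0 σ hσ N τ hτ Φ S f hS0 hf c hcm K hcK
  set μ : Measure (Phase N) := localGibbsLaw σ a₀ u₀ θ₀ N Φ with hμ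
  haveI : IsProbabilityMeasure μ := isProbabilityMeasure_localGibbsLaw ha hθ hu ha0 hθ0 hσ N Φ
  set ν : Measure (Phase N) := condLaw μ S with hν
  haveI : IsProbabilityMeasure ν := contactB_condLaw_isProbability μ S hS0 (measure_ne_top μ S)
  set Z : T3 → ℝ := fun y => ∫ v, Real.exp (c (y, v)) * localMaxwellian 1 (θ₀ y) (u₀ y) v with hZ
  have hZm : Measurable Z := kl_measurable_Z hθ hu hcm
  have hZmem : ∀ y, Real.exp (-K) ≤ Z y ∧ Z y ≤ Real.exp K := fun y => kl_Z_mem hθ0 hcm hcK y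
  have hZpos : ∀ y, 0 < Z y := fun y => (Real.exp_pos _).trans_le (hZmem y).1
  have hlogZ : ∀ y, |Real.log (Z y)| ≤ K := by
    intro y
    rw [abs_le]
    constructor
    · have := Real.log_le_log (Real.exp_pos _) (hZmem y).1
      rwa [Real.log_exp] at this
    · have := Real.log_le_log (hZpos y) (hZmem y).2
      rwa [Real.log_exp] at this
  -- the normalised tilt
  set ψ : T3 × V3 → ℝ := fun p => c p - Real.log (Z p.1) with hψ
  have hψm : Measurable ψ := hcm.sub (Real.measurable_log.comp (hZm.comp measurable_fst))
  have hψb : ∃ b : ℝ, ∀ p, |ψ p| ≤ b :=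
    ⟨K + K, fun p => (abs_sub _ _).trans (add_le_add (hcK p) (hlogZ p.1))⟩
  have hadm : ∀ y : T3, ∫ v, Real.exp (ψ (y, v)) ∂(gaussMeasure (u₀ y) (θ₀ y)) ≤ 1 := by
    intro y
    rw [kl_integral_gauss_eq (hθ0 y)]
    have h1 : (fun v => localMaxwellian 1 (θ₀ y) (u₀ y) v * Real.exp (ψ (y, v))) =
        fun v => (Z y)⁻¹ * (Real.exp (c (y, v)) * localMaxwellian 1 (θ₀ y) (u₀ y) v) := by
      funext v
      rw [hψ]
      dsimp only
      rw [Real.exp_sub, Real.exp_log (hZpos y)]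
      field_simp
    rw [h1, integral_const_mul]
    exact le_of_eq (inv_mul_cancel₀ (hZpos y).ne')
  -- the landed duality
  have hbud := contactB_velocityTiltBudget_bdd a₀ θ₀ u₀ ha hθ hu ha0 hθ0 hσ hτ Φ S f hS0 hf ψ hψm hψb hadm
  -- `∫ ψ f = ∫ c f − ∫ n_S log Z`
  have hfi : Integrable (fun p : T3 × V3 => f (0, p)) := tv_integrable_slice_zero ν Φ f hτ hf
  have hcfi : Integrable fun p : T3 × V3 => c p * f (0, p) :=
    hfi.bdd_mul hcm.aestronglyMeasurable (ae_of_all _ fun p => by rw [Real.norm_eq_abs]; exact hcK p)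
  have hlfi : Integrable fun p : T3 × V3 => Real.log (Z p.1) * f (0, p) :=
    hfi.bdd_mul (Real.measurable_log.comp (hZm.comp measurable_fst)).aestronglyMeasurable
      (ae_of_all _ fun p => by rw [Real.norm_eq_abs]; exact hlogZ p.1)
  have hsplit : ∫ p : T3 × V3, ψ p * f (0, p) =
      (∫ p : T3 × V3, c p * f (0, p)) - ∫ y : T3, Real.log (Z y) * ∫ v : V3, f (0, y, v) := by
    rw [← tv_integral_fst_mul_eq ν Φ f hτ hf (g := fun y => Real.log (Z y)) (Real.measurable_log.comp hZm) hlogZ,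
      ← integral_sub hcfi hlfi]
    refine integral_congr_ae (ae_of_all _ fun p => ?_)
    rw [hψ]; dsimp only; ring
  rw [hsplit] at hbud
  have hcomm : ∫ y : T3, (∫ v : V3, f (0, y, v)) * Real.log (Z y) = ∫ y : T3, Real.log (Z y) * ∫ v : V3, f (0, y, v) :=
    integral_congr_ae (ae_of_all _ fun y => mul_comm _ _)
  rw [hcomm]
  linarith

/-! ### Step 2: the truncated log-ratio tilt -/

/-- **Pointwise Gibbs inequality**: `F log(F/(n M)) ≥ F − n M` for `F ≥ 0`, `n ≥ 0`, `M > 0` (`log t ≥ 1 − 1/t`; the junk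
conventions `x/0 = 0`, `log 0 = 0` make the case `n = 0` read `0 ≥ F − 0`… no: for `n = 0` the left side is `0` and the right
side is `F ≥ 0`, so we state the inequality with the minorant `−n M`, which is what Fatou needs, and the sharp form for `n > 0`). -/
theorem kl_mul_log_ratio_ge {F n M : ℝ} (hF : 0 ≤ F) (hn : 0 ≤ n) (hM : 0 < M) :
    -(n * M) ≤ F * Real.log (F / (n * M)) ∧ (0 < n → F - n * M ≤ F * Real.log (F / (n * M))) := by
  have hsharp : 0 < n → F - n * M ≤ F * Real.log (F / (n * M)) := by
    intro hn0
    have hnM : 0 < n * M := mul_pos hn0 hM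
    rcases hF.eq_or_lt with hF0 | hF0
    · rw [← hF0]; simp; positivity
    · set t := F / (n * M) with ht
      have ht0 : 0 < t := div_pos hF0 hnM
      have hFt : F = n * M * t := by rw [ht]; field_simp
      -- `log t ≥ 1 − 1/t`
      have h1 : Real.log t⁻¹ ≤ t⁻¹ - 1 := Real.log_le_sub_one_of_pos (inv_pos.2 ht0)
      rw [Real.log_inv] at h1
      have h2 : 1 - t⁻¹ ≤ Real.log t := by linarith
      calc F - n * M = n * M * t * (1 - t⁻¹) := by rw [hFt]; field_simp
        _ ≤ n * M * t * Real.log t := mul_le_mul_of_nonneg_left h2 (by positivity)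
        _ = F * Real.log t := by rw [hFt]
  refine ⟨?_, hsharp⟩
  rcases hn.eq_or_lt with hn0 | hn0
  · rw [← hn0]; simp
  · have := hsharp hn0
    nlinarith [mul_pos hn0 hM]

/-- `e^{max a b} ≤ e^a + e^b`. -/
theorem kl_exp_max_le_add (a b : ℝ) : Real.exp (max a b) ≤ Real.exp a + Real.exp b := by
  rcases le_total a b with h | h
  · rw [max_eq_right h]; linarith [Real.exp_pos a]
  · rw [max_eq_left h]; linarith [Real.exp_pos b]

/-- **The partition function of the truncated log-ratio tilt is at most `1 + e^{−K}`** — at EVERY position, with no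
Jensen: for measurable `F ≥ 0` on `ℝ³` (a velocity slice `f(0,y,·)`), `n = ∫ F`, `M = M_{1,u,θ}` and
`c_K = 𝟙[F=0]·(−K) + 𝟙[F>0]·clamp_{[−K,K]} log(F/(nM))`: `∫ e^{c_K} M dv ≤ 1 + e^{−K}`
(`e^{clamp L} ≤ e^{−K} + e^{L}` on `{F > 0}` and `∫_{F>0} e^{L} M = ∫ F/n ≤ 1`). -/
theorem kl_Z_trunc_le {θ : ℝ} (hθ : 0 < θ) (u : V3) {F : V3 → ℝ} (hFm : Measurable F) (hF0 : ∀ v, 0 ≤ F v) {K : ℝ}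
    (hK : 0 ≤ K) :
    ∫ v, Real.exp (if F v = 0 then -K else
        max (-K) (min (Real.log (F v / ((∫ w, F w) * localMaxwellian 1 θ u v))) K)) * localMaxwellian 1 θ u v ≤
      1 + Real.exp (-K) := by
  set n : ℝ := ∫ w, F w with hn
  set M : V3 → ℝ := localMaxwellian 1 θ u with hM
  have hMi : Integrable M := integrable_localMaxwellian hθ u
  have hM1 : ∫ v, M v = 1 := integral_localMaxwellian_one hθ u
  have hMpos : ∀ v, 0 < M v := fun v => localMaxwellian_pos one_pos hθ u v
  have hn0 : 0 ≤ n := integral_nonneg hF0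
  -- the comparison function
  set g : V3 → ℝ := fun v => if n = 0 then M v else F v / n with hg
  have hg0 : ∀ v, 0 ≤ g v := fun v => by
    rw [hg]; dsimp only; split_ifs
    · exact (hMpos v).le
    · exact div_nonneg (hF0 v) hn0
  have hgi : Integrable g ∧ ∫ v, g v ≤ 1 := by
    by_cases h0 : n = 0
    · have : g = M := by funext v; rw [hg]; dsimp only; rw [if_pos h0]
      rw [this, hM1]; exact ⟨hMi, le_rfl⟩
    · have hnpos : 0 < n := lt_of_le_of_ne hn0 (Ne.symm h0)
      have hFi : Integrable F := by
        by_contra hni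
        exact h0 (by rw [hn, integral_undef hni])
      have : g = fun v => F v / n := by funext v; rw [hg]; dsimp only; rw [if_neg h0]
      rw [this]
      refine ⟨hFi.div_const _, ?_⟩
      rw [integral_div, ← hn, div_self h0]
  -- the pointwise bound `e^{c_K} M ≤ e^{-K} M + g`
  set c : V3 → ℝ := fun v => if F v = 0 then -K else
      max (-K) (min (Real.log (F v / (n * M v))) K) with hc
  have hcm : Measurable c := by
    refine Measurable.ite (measurableSet_eq_fun hFm measurable_const) measurable_const ?_
    exact measurable_const.max ((Real.measurable_log.comp (hFm.div (measurable_const.mul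
      (continuous_localMaxwellian 1 θ u).measurable))).min measurable_const)
  have hcK : ∀ v, c v ≤ max (-K) (Real.log (F v / (n * M v))) ∨ F v = 0 := by
    intro v
    by_cases hv : F v = 0
    · exact Or.inr hv
    · left; rw [hc]; dsimp only; rw [if_neg hv]
      exact max_le_max le_rfl (min_le_left _ _)
  have hpt : ∀ v, Real.exp (c v) * M v ≤ Real.exp (-K) * M v + g v := by
    intro v
    have hMv := hMpos v
    by_cases hv : F v = 0
    · have : c v = -K := by rw [hc]; dsimp only; rw [if_pos hv]
      rw [this]
      linarith [hg0 v]
    · have hcv : c v ≤ max (-K) (Real.log (F v / (n * M v))) := by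
        rcases hcK v with h | h
        · exact h
        · exact absurd h hv
      have hFpos : 0 < F v := lt_of_le_of_ne (hF0 v) (Ne.symm hv)
      have e1 : Real.exp (c v) ≤ Real.exp (-K) + Real.exp (Real.log (F v / (n * M v))) := by
        calc Real.exp (c v) ≤ Real.exp (max (-K) (Real.log (F v / (n * M v)))) := Real.exp_le_exp.2 hcv
          _ ≤ Real.exp (-K) + Real.exp (Real.log (F v / (n * M v))) := kl_exp_max_le_add _ _
      by_cases h0 : n = 0
      · -- `n = 0`: the ratio is the junk `0`, `e^{log 0} = 1`, and `g = M`
        have hg' : g v = M v := by rw [hg]; dsimp only; rw [if_pos h0]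
        have : Real.exp (Real.log (F v / (n * M v))) = 1 := by rw [h0, zero_mul, div_zero, Real.log_zero, Real.exp_zero]
        rw [this] at e1
        rw [hg']
        nlinarith [hMv]
      · have hnpos : 0 < n := lt_of_le_of_ne hn0 (Ne.symm h0)
        have hg' : g v = F v / n := by rw [hg]; dsimp only; rw [if_neg h0]
        have hratio : 0 < F v / (n * M v) := div_pos hFpos (mul_pos hnpos hMv)
        rw [Real.exp_log hratio] at e1
        have e2 : Real.exp (c v) * M v ≤ (Real.exp (-K) + F v / (n * M v)) * M v :=
          mul_le_mul_of_nonneg_right e1 hMv.le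
        have e3 : (Real.exp (-K) + F v / (n * M v)) * M v = Real.exp (-K) * M v + F v / n := by
          field_simp
        rw [hg']
        linarith [e2, e3.le]
  -- `|c| ≤ K`
  have hcb : ∀ v, |c v| ≤ K := by
    intro v
    rw [hc]; dsimp only
    split_ifs
    · rw [abs_neg, abs_of_nonneg hK]
    · rw [abs_le]
      exact ⟨le_max_left _ _, max_le (by linarith) (min_le_right _ _)⟩
  -- integrate
  have hci : Integrable fun v => Real.exp (c v) * M v :=
    hMi.bdd_mul (Real.measurable_exp.comp hcm).aestronglyMeasurable (ae_of_all _ fun v => by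
      rw [Real.norm_eq_abs, abs_of_pos (Real.exp_pos _)]
      exact Real.exp_le_exp.2 (abs_le.1 (hcb v)).2)
  show ∫ v, Real.exp (c v) * M v ≤ 1 + Real.exp (-K)
  calc ∫ v, Real.exp (c v) * M v ≤ ∫ v, (Real.exp (-K) * M v + g v) :=
        integral_mono hci ((hMi.const_mul _).add hgi.1) hpt
    _ = Real.exp (-K) + ∫ v, g v := by
        rw [integral_add (hMi.const_mul _) hgi.1, integral_const_mul, hM1, mul_one]
    _ ≤ 1 + Real.exp (-K) := by linarith [hgi.2]

end Summit.AtomisticToContinuum.HydrodynamicLimit.Theorems.LocalSecondLawInitialMatching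

end
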